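import Summits.NavierStokesRegularity.NavierStokesRegularity.Theorems.ExtremiserTransienceNearExtremalTransienceExtremiserLiouvilleConstantSpeedSlideQuotientLimit
import Summits.NavierStokesRegularity.NavierStokesRegularity.Theorems.ExtremiserTransienceNearExtremalTransienceExtremiserLiouvilleConstantSpeedSlideVariationLipschitz
import HarnessLib

/-!
# Crux `ExtremiserTransience.NearExtremalTransience` (stmt-NavierStokesRegularity-21883), line `extremiser_liouville`,
# stub K1b — THE ENSTROPHY AND STRETCHING VARIATIONS PASS TO THE LIMIT along the discrete slide (record §13, R1)

`--supports stmt-NavierStokesRegularity-21883` (helper).  Author: prover seat `ns-el-k1b` (g8).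

With `ψ_h = −h⁻¹φ̂_h` (discrete slide direction, `slideKKT`) and `φ_g = g∂₂V + g′V_h` (slide generator; apply with `V = v − c`):
* `abs_firstVar_enstrophy_sub_le`, `abs_firstVar_stretching_sub_le` : the variations of two directions differ by at most
  `4√Z‖Dψ₁ − Dψ₂‖₂`, `12B√Z‖Dψ₁ − Dψ₂‖₂` (from …SlideVariationLipschitz applied to `ψ₁ − ψ₂`);
* `integrable_sq_norm_fderiv_slideGenerator` : `Dφ_g ∈ L²` (`Dφ_g = D²Ψe₂ − DG⊗e₂`);
* `tendsto_firstVar_enstrophy_slideQuotient` : **`a₁(ψ_h) → a₁(−φ_g)` as `h → 0⁺`** (by `tendsto_lintegral_fderiv_slideQuotient_sub`);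
  the `J₁` analogue is identical with `abs_firstVar_stretching_sub_le` (next file).
So in `slideKKT` the `J₁` and `a₁` terms converge; the `c₁` term is bounded above via the discrete product rule (R2–R4).

WHAT THIS IS NOT: K1b is NOT proved; nothing here proves NS regularity. [folklore]
-/

noncomputable section

open Set Filter Topology MeasureTheory Metric Function InnerProductSpace
open scoped ENNReal NNReal Topology InnerProductSpace RealInnerProductSpace ContDiff
open Literature.Analysis.FluidPDE Literature.Analysis

namespace Summit.NavierStokesRegularity.NavierStokesRegularity.Theorems

-- the problem directory repeats the summit name (`NavierStokesRegularity/NavierStokesRegularity`)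
set_option linter.dupNamespace false

namespace ExtremiserLiouville

open DepletionLadder.KStar

variable {v ψ₁ ψ₂ : EuclideanSpace ℝ (Fin 3) → EuclideanSpace ℝ (Fin 3)} {g : ℝ → ℝ}

/-! ## 1. Differences of directions -/

/-- `a₁` of two directions: `|∫⟪ω, curl ψ₁⟫ − ∫⟪ω, curl ψ₂⟫| ≤ 4√Z·√(∫‖Dψ₁ − Dψ₂‖²)`. [folklore] -/
theorem abs_firstVar_enstrophy_sub_le (hv : ContDiff ℝ 1 v) (hψ₁ : ContDiff ℝ 1 ψ₁) (hψ₂ : ContDiff ℝ 1 ψ₂)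
    (hZ : Integrable (fun x => ‖curl v x‖ ^ 2) (volume : Measure (EuclideanSpace ℝ (Fin 3))))
    (hD₁ : Integrable (fun x => ‖fderiv ℝ ψ₁ x‖ ^ 2) (volume : Measure (EuclideanSpace ℝ (Fin 3))))
    (hD₂ : Integrable (fun x => ‖fderiv ℝ ψ₂ x‖ ^ 2) (volume : Measure (EuclideanSpace ℝ (Fin 3)))) :
    |(∫ x, ⟪curl v x, curl ψ₁ x⟫) - ∫ x, ⟪curl v x, curl ψ₂ x⟫| ≤
      4 * Real.sqrt (∫ x, ‖curl v x‖ ^ 2) * Real.sqrt (∫ x, ‖fderiv ℝ ψ₁ x - fderiv ℝ ψ₂ x‖ ^ 2) := by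
  have hθ : ContDiff ℝ 1 (fun y => ψ₁ y - ψ₂ y) := hψ₁.sub hψ₂
  have hd₁ : Differentiable ℝ ψ₁ := hψ₁.differentiable one_ne_zero
  have hd₂ : Differentiable ℝ ψ₂ := hψ₂.differentiable one_ne_zero
  have hDθ : ∀ x, fderiv ℝ (fun y => ψ₁ y - ψ₂ y) x = fderiv ℝ ψ₁ x - fderiv ℝ ψ₂ x := fun x =>
    fderiv_fun_sub (hd₁ x) (hd₂ x)
  have hDθ2 : Integrable (fun x => ‖fderiv ℝ (fun y => ψ₁ y - ψ₂ y) x‖ ^ 2) (volume : Measure (EuclideanSpace ℝ (Fin 3))) := by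
    have e : (fun x => ‖fderiv ℝ (fun y => ψ₁ y - ψ₂ y) x‖ ^ 2) = fun x => ‖fderiv ℝ ψ₁ x - fderiv ℝ ψ₂ x‖ ^ 2 := by
      funext x; rw [hDθ]
    rw [e]
    refine ((hD₁.const_mul 2).add (hD₂.const_mul 2)).mono'
      (((hψ₁.continuous_fderiv one_ne_zero).sub (hψ₂.continuous_fderiv one_ne_zero)).norm.pow 2).aestronglyMeasurable
      (Eventually.of_forall fun x => ?_)
    rw [Real.norm_eq_abs, abs_of_nonneg (sq_nonneg _)]
    simp only [Pi.add_apply]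
    nlinarith [norm_sub_le (fderiv ℝ ψ₁ x) (fderiv ℝ ψ₂ x), norm_nonneg (fderiv ℝ ψ₁ x - fderiv ℝ ψ₂ x),
      norm_nonneg (fderiv ℝ ψ₁ x), norm_nonneg (fderiv ℝ ψ₂ x), sq_nonneg (‖fderiv ℝ ψ₁ x‖ - ‖fderiv ℝ ψ₂ x‖)]
  -- integrability of the two pairings
  have cω : Continuous (curl v) := continuous_curl hv
  have mω : MemLp (curl v) 2 (volume : Measure (EuclideanSpace ℝ (Fin 3))) :=
    (memLp_two_iff_integrable_sq_norm cω.aestronglyMeasurable).2 hZ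
  have ipair : ∀ {ψ : EuclideanSpace ℝ (Fin 3) → EuclideanSpace ℝ (Fin 3)}, ContDiff ℝ 1 ψ →
      Integrable (fun x => ‖fderiv ℝ ψ x‖ ^ 2) (volume : Measure (EuclideanSpace ℝ (Fin 3))) →
      Integrable (fun x => ⟪curl v x, curl ψ x⟫) (volume : Measure (EuclideanSpace ℝ (Fin 3))) := by
    intro ψ hψ hD
    have cψ : Continuous (curl ψ) := continuous_curl hψ
    have mψ : MemLp (curl ψ) 2 (volume : Measure (EuclideanSpace ℝ (Fin 3))) :=
      memLp_two_of_norm_le_mul cψ (hψ.continuous_fderiv one_ne_zero) hD (norm_curl_le_four_mul ψ)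
    exact (mω.norm.integrable_mul mψ.norm).mono' (cω.inner cψ).aestronglyMeasurable
      (Eventually.of_forall fun x => by rw [Real.norm_eq_abs]; exact abs_real_inner_le_norm _ _)
  rw [← integral_sub (ipair hψ₁ hD₁) (ipair hψ₂ hD₂)]
  have hpt : ∀ x, ⟪curl v x, curl ψ₁ x⟫ - ⟪curl v x, curl ψ₂ x⟫ = ⟪curl v x, curl (fun y => ψ₁ y - ψ₂ y) x⟫ := by
    intro x
    rw [← inner_sub_right, curl_eq_curlCLM, curl_eq_curlCLM, curl_eq_curlCLM, curl_eq_curlCLM, hDθ, map_sub]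
  simp_rw [hpt]
  have h := abs_firstVar_enstrophy_le hv hθ hZ hDθ2
  have e' : (fun x => ‖fderiv ℝ (fun y => ψ₁ y - ψ₂ y) x‖ ^ 2) = fun x => ‖fderiv ℝ ψ₁ x - fderiv ℝ ψ₂ x‖ ^ 2 := by
    funext x; rw [hDθ]
  rw [e'] at h
  exact h

/-- `J₁` of two directions: `|J₁(ψ₁) − J₁(ψ₂)| ≤ 12B√Z·√(∫‖Dψ₁ − Dψ₂‖²)`. [folklore] -/
theorem abs_firstVar_stretching_sub_le (hv : ContDiff ℝ 1 v) (hψ₁ : ContDiff ℝ 1 ψ₁) (hψ₂ : ContDiff ℝ 1 ψ₂) {B : ℝ}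
    (hB : ∀ x, ‖fderiv ℝ v x‖ ≤ B)
    (hZ : Integrable (fun x => ‖curl v x‖ ^ 2) (volume : Measure (EuclideanSpace ℝ (Fin 3))))
    (hD₁ : Integrable (fun x => ‖fderiv ℝ ψ₁ x‖ ^ 2) (volume : Measure (EuclideanSpace ℝ (Fin 3))))
    (hD₂ : Integrable (fun x => ‖fderiv ℝ ψ₂ x‖ ^ 2) (volume : Measure (EuclideanSpace ℝ (Fin 3)))) :
    |(∫ x, (⟪curl ψ₁ x, fderiv ℝ v x (curl v x)⟫ + ⟪curl v x, fderiv ℝ ψ₁ x (curl v x)⟫ +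
        ⟪curl v x, fderiv ℝ v x (curl ψ₁ x)⟫)) -
      ∫ x, (⟪curl ψ₂ x, fderiv ℝ v x (curl v x)⟫ + ⟪curl v x, fderiv ℝ ψ₂ x (curl v x)⟫ +
        ⟪curl v x, fderiv ℝ v x (curl ψ₂ x)⟫)| ≤
      12 * B * Real.sqrt (∫ x, ‖curl v x‖ ^ 2) * Real.sqrt (∫ x, ‖fderiv ℝ ψ₁ x - fderiv ℝ ψ₂ x‖ ^ 2) := by
  have hθ : ContDiff ℝ 1 (fun y => ψ₁ y - ψ₂ y) := hψ₁.sub hψ₂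
  have hd₁ : Differentiable ℝ ψ₁ := hψ₁.differentiable one_ne_zero
  have hd₂ : Differentiable ℝ ψ₂ := hψ₂.differentiable one_ne_zero
  have hDθ : ∀ x, fderiv ℝ (fun y => ψ₁ y - ψ₂ y) x = fderiv ℝ ψ₁ x - fderiv ℝ ψ₂ x := fun x =>
    fderiv_fun_sub (hd₁ x) (hd₂ x)
  have hDθ2 : Integrable (fun x => ‖fderiv ℝ (fun y => ψ₁ y - ψ₂ y) x‖ ^ 2) (volume : Measure (EuclideanSpace ℝ (Fin 3))) := by
    have e : (fun x => ‖fderiv ℝ (fun y => ψ₁ y - ψ₂ y) x‖ ^ 2) = fun x => ‖fderiv ℝ ψ₁ x - fderiv ℝ ψ₂ x‖ ^ 2 := by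
      funext x; rw [hDθ]
    rw [e]
    refine ((hD₁.const_mul 2).add (hD₂.const_mul 2)).mono'
      (((hψ₁.continuous_fderiv one_ne_zero).sub (hψ₂.continuous_fderiv one_ne_zero)).norm.pow 2).aestronglyMeasurable
      (Eventually.of_forall fun x => ?_)
    rw [Real.norm_eq_abs, abs_of_nonneg (sq_nonneg _)]
    simp only [Pi.add_apply]
    nlinarith [norm_sub_le (fderiv ℝ ψ₁ x) (fderiv ℝ ψ₂ x), norm_nonneg (fderiv ℝ ψ₁ x - fderiv ℝ ψ₂ x),
      norm_nonneg (fderiv ℝ ψ₁ x), norm_nonneg (fderiv ℝ ψ₂ x), sq_nonneg (‖fderiv ℝ ψ₁ x‖ - ‖fderiv ℝ ψ₂ x‖)]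
  have cω : Continuous (curl v) := continuous_curl hv
  have cDv : Continuous (fderiv ℝ v) := hv.continuous_fderiv one_ne_zero
  have hB0 : 0 ≤ B := (norm_nonneg _).trans (hB 0)
  have hω : ∀ x, ‖curl v x‖ ≤ 4 * B := fun x =>
    (norm_curl_le_four_mul v x).trans (mul_le_mul_of_nonneg_left (hB x) (by norm_num))
  have mω : MemLp (curl v) 2 (volume : Measure (EuclideanSpace ℝ (Fin 3))) :=
    (memLp_two_iff_integrable_sq_norm cω.aestronglyMeasurable).2 hZ
  have mDvω : MemLp (fun x => fderiv ℝ v x (curl v x)) 2 (volume : Measure (EuclideanSpace ℝ (Fin 3))) :=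
    memLp_two_of_norm_le_mul (cDv.clm_apply cω) cω hZ fun x =>
      ((fderiv ℝ v x).le_opNorm _).trans (mul_le_mul_of_nonneg_right (hB x) (norm_nonneg _))
  have iab : ∀ {a b : EuclideanSpace ℝ (Fin 3) → EuclideanSpace ℝ (Fin 3)},
      MemLp a 2 (volume : Measure (EuclideanSpace ℝ (Fin 3))) → MemLp b 2 (volume : Measure (EuclideanSpace ℝ (Fin 3))) →
      Continuous a → Continuous b →
      Integrable (fun x => ⟪a x, b x⟫) (volume : Measure (EuclideanSpace ℝ (Fin 3))) := by
    intro a b ha hb ca cb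
    exact (ha.norm.integrable_mul hb.norm).mono' (ca.inner cb).aestronglyMeasurable
      (Eventually.of_forall fun x => by rw [Real.norm_eq_abs]; exact abs_real_inner_le_norm _ _)
  -- integrability of the three pairings for a general direction
  have iJ : ∀ {ψ : EuclideanSpace ℝ (Fin 3) → EuclideanSpace ℝ (Fin 3)}, ContDiff ℝ 1 ψ →
      Integrable (fun x => ‖fderiv ℝ ψ x‖ ^ 2) (volume : Measure (EuclideanSpace ℝ (Fin 3))) →
      Integrable (fun x => ⟪curl ψ x, fderiv ℝ v x (curl v x)⟫ + ⟪curl v x, fderiv ℝ ψ x (curl v x)⟫ +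
        ⟪curl v x, fderiv ℝ v x (curl ψ x)⟫) (volume : Measure (EuclideanSpace ℝ (Fin 3))) := by
    intro ψ hψ hD
    have cψ : Continuous (curl ψ) := continuous_curl hψ
    have cD : Continuous (fderiv ℝ ψ) := hψ.continuous_fderiv one_ne_zero
    have mψ : MemLp (curl ψ) 2 (volume : Measure (EuclideanSpace ℝ (Fin 3))) :=
      memLp_two_of_norm_le_mul cψ cD hD (norm_curl_le_four_mul ψ)
    have mDψω : MemLp (fun x => fderiv ℝ ψ x (curl v x)) 2 (volume : Measure (EuclideanSpace ℝ (Fin 3))) :=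
      memLp_two_of_norm_le_mul (cD.clm_apply cω) cD hD fun x => by
        rw [mul_comm]; exact ((fderiv ℝ ψ x).le_opNorm _).trans (mul_le_mul_of_nonneg_left (hω x) (norm_nonneg _))
    have mDvψ : MemLp (fun x => fderiv ℝ v x (curl ψ x)) 2 (volume : Measure (EuclideanSpace ℝ (Fin 3))) :=
      memLp_two_of_norm_le_mul (cDv.clm_apply cψ) cD hD fun x =>
        calc ‖fderiv ℝ v x (curl ψ x)‖ ≤ ‖fderiv ℝ v x‖ * ‖curl ψ x‖ := (fderiv ℝ v x).le_opNorm _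
          _ ≤ B * (4 * ‖fderiv ℝ ψ x‖) := mul_le_mul (hB x) (norm_curl_le_four_mul ψ x) (norm_nonneg _) hB0
          _ = (4 * B) * ‖fderiv ℝ ψ x‖ := by ring
    exact ((iab mψ mDvω cψ (cDv.clm_apply cω)).add (iab mω mDψω cω (cD.clm_apply cω))).add
      (iab mω mDvψ cω (cDv.clm_apply cψ))
  rw [← integral_sub (iJ hψ₁ hD₁) (iJ hψ₂ hD₂)]
  have hpt : ∀ x, (⟪curl ψ₁ x, fderiv ℝ v x (curl v x)⟫ + ⟪curl v x, fderiv ℝ ψ₁ x (curl v x)⟫ +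
        ⟪curl v x, fderiv ℝ v x (curl ψ₁ x)⟫) -
      (⟪curl ψ₂ x, fderiv ℝ v x (curl v x)⟫ + ⟪curl v x, fderiv ℝ ψ₂ x (curl v x)⟫ +
        ⟪curl v x, fderiv ℝ v x (curl ψ₂ x)⟫) =
      ⟪curl (fun y => ψ₁ y - ψ₂ y) x, fderiv ℝ v x (curl v x)⟫ +
        ⟪curl v x, fderiv ℝ (fun y => ψ₁ y - ψ₂ y) x (curl v x)⟫ +
        ⟪curl v x, fderiv ℝ v x (curl (fun y => ψ₁ y - ψ₂ y) x)⟫ := by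
    intro x
    have hc : curl (fun y => ψ₁ y - ψ₂ y) x = curl ψ₁ x - curl ψ₂ x := by
      rw [curl_eq_curlCLM, curl_eq_curlCLM, curl_eq_curlCLM, hDθ, map_sub]
    rw [hc, hDθ, inner_sub_left, sub_apply, inner_sub_right, map_sub, inner_sub_right]
    ring
  simp_rw [hpt]
  have h := abs_firstVar_stretching_le hv hθ hB hZ hDθ2
  have e' : (fun x => ‖fderiv ℝ (fun y => ψ₁ y - ψ₂ y) x‖ ^ 2) = fun x => ‖fderiv ℝ ψ₁ x - fderiv ℝ ψ₂ x‖ ^ 2 := by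
    funext x; rw [hDθ]
  rw [e'] at h
  exact h

/-! ## 2. Along the discrete slide: `Dφ_g ∈ L²`, `Dψ_h ∈ L²`, and the limits -/

/-- `∫‖f‖² = (∫⁻‖f‖ₑ²).toReal`. [folklore] -/
theorem integral_sq_norm_eq_toReal_lintegral {F' : Type*} [NormedAddCommGroup F'] {f : EuclideanSpace ℝ (Fin 3) → F'}
    (hf : AEStronglyMeasurable f (volume : Measure (EuclideanSpace ℝ (Fin 3)))) :
    (∫ x, ‖f x‖ ^ 2) = (∫⁻ x, ‖f x‖ₑ ^ 2).toReal := by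
  rw [integral_eq_lintegral_of_nonneg_ae (Eventually.of_forall fun x => sq_nonneg _) (hf.norm.pow 2)]
  congr 1
  refine lintegral_congr fun x => ?_
  rw [← ofReal_norm, ENNReal.ofReal_pow (norm_nonneg _)]

variable {V : EuclideanSpace ℝ (Fin 3) → EuclideanSpace ℝ (Fin 3)}

/-- **`Dφ_g ∈ L²`** for the slide generator on a square-integrable layer (`Dφ_g = D²Ψe₂ − DG⊗e₂`). [folklore] -/
theorem integrable_sq_norm_fderiv_slideGenerator (hV : ContDiff ℝ ∞ V) (hg : ContDiff ℝ ∞ g) {T K0 K1 K2 K3 : ℝ}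
    (hK0 : ∀ s, |g s| ≤ K0) (hK1 : ∀ s, |deriv g s| ≤ K1) (hK2 : ∀ s, |deriv (deriv g) s| ≤ K2)
    (hK3 : ∀ s, |deriv (deriv (deriv g)) s| ≤ K3)
    (hT1 : ∀ s, T < |s| → deriv g s = 0) (hT2 : ∀ s, T < |s| → deriv (deriv g) s = 0)
    (hT3 : ∀ s, T < |s| → deriv (deriv (deriv g)) s = 0)
    (h1 : ∫⁻ x, ‖iteratedFDeriv ℝ 1 V x‖ₑ ^ 2 < ⊤) (h2 : ∫⁻ x, ‖iteratedFDeriv ℝ 2 V x‖ₑ ^ 2 < ⊤)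
    (hslab : Integrable (fun x => {x : EuclideanSpace ℝ (Fin 3) | |x 2| ≤ T}.indicator (fun x => ‖V x‖ ^ 2) x) volume) :
    Integrable (fun x => ‖fderiv ℝ (fun y : EuclideanSpace ℝ (Fin 3) => (g (y 2) • fderiv ℝ V y (EuclideanSpace.single (2 : Fin 3) (1 : ℝ)) + deriv g (y 2) • (V y - (V y 2) • EuclideanSpace.single (2 : Fin 3) (1 : ℝ)))) x‖ ^ 2)
      (volume : Measure (EuclideanSpace ℝ (Fin 3))) := by
  set e₂ : EuclideanSpace ℝ (Fin 3) := EuclideanSpace.single (2 : Fin 3) (1 : ℝ) with he₂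
  set Ψ : EuclideanSpace ℝ (Fin 3) → EuclideanSpace ℝ (Fin 3) := fun z => g (z 2) • V z with hΨ
  set G : EuclideanSpace ℝ (Fin 3) → ℝ := fun z => deriv g (z 2) * V z 2 with hG
  have hproj : ContDiff ℝ ∞ fun y : EuclideanSpace ℝ (Fin 3) => y 2 :=
    (EuclideanSpace.proj (2 : Fin 3) : EuclideanSpace ℝ (Fin 3) →L[ℝ] ℝ).contDiff
  have hΨs : ContDiff ℝ ∞ Ψ := (hg.comp hproj).smul hV
  have hγ : ContDiff ℝ ∞ (deriv g) := (contDiff_infty_iff_deriv.mp hg).2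
  have hGs : ContDiff ℝ ∞ G := (hγ.comp hproj).mul (hproj.comp hV)
  obtain ⟨-, hΨ2⟩ := lintegral_iteratedFDeriv_axialWeight_smul_lt_top hV hg hK0 hK1 hK2 hT1 hT2 h1 h2 hslab
  obtain ⟨hG1, -⟩ := lintegral_iteratedFDeriv_axialWeight_mul_coord_lt_top hV hg hK1 hK2 hK3 hT2 hT3 h1 h2 hslab
  have iΨ2 : Integrable (fun x => ‖iteratedFDeriv ℝ 2 Ψ x‖ ^ 2) (volume : Measure (EuclideanSpace ℝ (Fin 3))) :=
    integrable_sq_norm_of_lintegral (hΨs.continuous_iteratedFDeriv (WithTop.coe_le_coe.mpr le_top)) hΨ2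
  have iG1 : Integrable (fun x => ‖iteratedFDeriv ℝ 1 G x‖ ^ 2) (volume : Measure (EuclideanSpace ℝ (Fin 3))) :=
    integrable_sq_norm_of_lintegral (hGs.continuous_iteratedFDeriv (WithTop.coe_le_coe.mpr le_top)) hG1
  have hφgs : ContDiff ℝ ∞ fun y : EuclideanSpace ℝ (Fin 3) => g (y 2) • fderiv ℝ V y e₂ + deriv g (y 2) • (V y - (V y 2) • e₂) :=
    ((hg.comp hproj).smul ((hV.fderiv_right (m := ∞) (by exact_mod_cast le_rfl)).clm_apply contDiff_const)).add
      ((hγ.comp hproj).smul (hV.sub ((hproj.comp hV).smul contDiff_const)))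
  refine ((iΨ2.const_mul 2).add (iG1.const_mul 2)).mono'
    ((hφgs.continuous_fderiv (by simp)).norm.pow 2).aestronglyMeasurable (Eventually.of_forall fun x => ?_)
  rw [Real.norm_eq_abs, abs_of_nonneg (sq_nonneg _), fderiv_slideGenerator_eq' hV hg x]
  have ha : ‖fderiv ℝ (fderiv ℝ Ψ) x e₂‖ ≤ ‖iteratedFDeriv ℝ 2 Ψ x‖ := by
    rw [← norm_iteratedFDeriv_fderiv, ← norm_iteratedFDeriv_fderiv, norm_iteratedFDeriv_zero]
    calc ‖fderiv ℝ (fderiv ℝ Ψ) x e₂‖ ≤ ‖fderiv ℝ (fderiv ℝ Ψ) x‖ * ‖e₂‖ := ContinuousLinearMap.le_opNorm _ _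
      _ = ‖fderiv ℝ (fderiv ℝ Ψ) x‖ := by rw [he₂, PiLp.norm_single, norm_one, mul_one]
  have hb : ‖(fderiv ℝ G x).smulRight e₂‖ = ‖iteratedFDeriv ℝ 1 G x‖ := by
    rw [ContinuousLinearMap.norm_smulRight_apply, he₂, PiLp.norm_single, norm_one, mul_one, ← norm_iteratedFDeriv_fderiv,
      norm_iteratedFDeriv_zero]
  have hn := norm_sub_le (fderiv ℝ (fderiv ℝ Ψ) x e₂) ((fderiv ℝ G x).smulRight e₂)
  rw [hb] at hn
  have key : ‖fderiv ℝ (fderiv ℝ Ψ) x e₂ - (fderiv ℝ G x).smulRight e₂‖ ≤ ‖iteratedFDeriv ℝ 2 Ψ x‖ + ‖iteratedFDeriv ℝ 1 G x‖ :=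
    hn.trans (add_le_add ha le_rfl)
  have h0 := norm_nonneg (fderiv ℝ (fderiv ℝ Ψ) x e₂ - (fderiv ℝ G x).smulRight e₂)
  have ha0 := norm_nonneg (iteratedFDeriv ℝ 2 Ψ x)
  have hb0 := norm_nonneg (iteratedFDeriv ℝ 1 G x)
  simp only [Pi.add_apply]
  nlinarith [mul_nonneg (sub_nonneg.2 key) (add_nonneg (add_nonneg ha0 hb0) h0),
    sq_nonneg (‖iteratedFDeriv ℝ 2 Ψ x‖ - ‖iteratedFDeriv ℝ 1 G x‖)]

/-- **`Dψ_h ∈ L²`** for the normalised discrete slide direction `ψ_h = −h⁻¹φ̂_h`. [folklore] -/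
theorem integrable_sq_norm_fderiv_slideQuotient_smul (hV : ContDiff ℝ ∞ V) (hg : ContDiff ℝ ∞ g) {T K0 K1 K2 K3 : ℝ}
    (hK0 : ∀ s, |g s| ≤ K0) (hK1 : ∀ s, |deriv g s| ≤ K1) (hK2 : ∀ s, |deriv (deriv g) s| ≤ K2)
    (hK3 : ∀ s, |deriv (deriv (deriv g)) s| ≤ K3)
    (hT1 : ∀ s, T < |s| → deriv g s = 0) (hT2 : ∀ s, T < |s| → deriv (deriv g) s = 0)
    (hT3 : ∀ s, T < |s| → deriv (deriv (deriv g)) s = 0)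
    (h1 : ∫⁻ x, ‖iteratedFDeriv ℝ 1 V x‖ₑ ^ 2 < ⊤) (h2 : ∫⁻ x, ‖iteratedFDeriv ℝ 2 V x‖ₑ ^ 2 < ⊤)
    (hslab : Integrable (fun x => {x : EuclideanSpace ℝ (Fin 3) | |x 2| ≤ T}.indicator (fun x => ‖V x‖ ^ 2) x) volume)
    {h : ℝ} (hh : 0 ≤ h) (a : ℝ) :
    Integrable (fun x => ‖fderiv ℝ (fun x : EuclideanSpace ℝ (Fin 3) => a • (g (x 2) • V x - g ((x + (-h) • EuclideanSpace.single (2 : Fin 3) (1 : ℝ)) 2) • V (x + (-h) • EuclideanSpace.single (2 : Fin 3) (1 : ℝ)) -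
          (∫ t in (-h)..0, deriv g ((x + t • EuclideanSpace.single (2 : Fin 3) (1 : ℝ)) 2) * V (x + t • EuclideanSpace.single (2 : Fin 3) (1 : ℝ)) 2) • EuclideanSpace.single (2 : Fin 3) (1 : ℝ))) x‖ ^ 2)
      (volume : Measure (EuclideanSpace ℝ (Fin 3))) := by
  set e₂ : EuclideanSpace ℝ (Fin 3) := EuclideanSpace.single (2 : Fin 3) (1 : ℝ) with he₂
  set φ : EuclideanSpace ℝ (Fin 3) → EuclideanSpace ℝ (Fin 3) := fun x =>
    g (x 2) • V x - g ((x + (-h) • e₂) 2) • V (x + (-h) • e₂) -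
      (∫ t in (-h)..0, deriv g ((x + t • e₂) 2) * V (x + t • e₂) 2) • e₂ with hφdef
  have hφs : ContDiff ℝ ∞ φ := contDiff_slideQuotient hV hg h
  have hφd : Differentiable ℝ φ := hφs.differentiable (by simp)
  obtain ⟨hL1, -⟩ := lintegral_iteratedFDeriv_slideQuotient_lt_top hV hg hK0 hK1 hK2 hK3 hT1 hT2 hT3 h1 h2 hslab hh
  have iφ1 : Integrable (fun x => ‖iteratedFDeriv ℝ 1 φ x‖ ^ 2) (volume : Measure (EuclideanSpace ℝ (Fin 3))) :=
    integrable_sq_norm_of_lintegral (hφs.continuous_iteratedFDeriv (WithTop.coe_le_coe.mpr le_top)) hL1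
  have hψs : ContDiff ℝ ∞ fun x => a • φ x := hφs.const_smul a
  refine (iφ1.const_mul (a ^ 2)).mono' ((hψs.continuous_fderiv (by simp)).norm.pow 2).aestronglyMeasurable
    (Eventually.of_forall fun x => ?_)
  have hD : fderiv ℝ (fun x => a • φ x) x = a • fderiv ℝ φ x := ((hφd x).hasFDerivAt.const_smul a).fderiv
  rw [Real.norm_eq_abs, abs_of_nonneg (sq_nonneg _), hD, norm_smul, mul_pow, Real.norm_eq_abs, sq_abs,
    ← norm_iteratedFDeriv_fderiv, norm_iteratedFDeriv_zero]

/-- **The enstrophy variation passes to the limit along the discrete slide**: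
`∫⟪curl v, curl(−h⁻¹φ̂_h)⟫ → ∫⟪curl v, curl(−φ_g)⟫` as `h → 0⁺`, for any `C¹` field `v` with `curl v ∈ L²` and the slide data
`V, g` of a square-integrable layer (apply with `V = v − c`). [folklore] -/
theorem tendsto_firstVar_enstrophy_slideQuotient (hv : ContDiff ℝ 1 v)
    (hZ : Integrable (fun x => ‖curl v x‖ ^ 2) (volume : Measure (EuclideanSpace ℝ (Fin 3))))
    (hV : ContDiff ℝ ∞ V) (hg : ContDiff ℝ ∞ g) {T K0 K1 K2 K3 : ℝ}
    (hK0 : ∀ s, |g s| ≤ K0) (hK1 : ∀ s, |deriv g s| ≤ K1) (hK2 : ∀ s, |deriv (deriv g) s| ≤ K2)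
    (hK3 : ∀ s, |deriv (deriv (deriv g)) s| ≤ K3)
    (hT1 : ∀ s, T < |s| → deriv g s = 0) (hT2 : ∀ s, T < |s| → deriv (deriv g) s = 0)
    (hT3 : ∀ s, T < |s| → deriv (deriv (deriv g)) s = 0)
    (h1 : ∫⁻ x, ‖iteratedFDeriv ℝ 1 V x‖ₑ ^ 2 < ⊤) (h2 : ∫⁻ x, ‖iteratedFDeriv ℝ 2 V x‖ₑ ^ 2 < ⊤)
    (hslab : Integrable (fun x => {x : EuclideanSpace ℝ (Fin 3) | |x 2| ≤ T}.indicator (fun x => ‖V x‖ ^ 2) x) volume) :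
    Tendsto (fun h : ℝ => ∫ x, ⟪curl v x, curl (fun x : EuclideanSpace ℝ (Fin 3) => (-h⁻¹) • (g (x 2) • V x - g ((x + (-h) • EuclideanSpace.single (2 : Fin 3) (1 : ℝ)) 2) • V (x + (-h) • EuclideanSpace.single (2 : Fin 3) (1 : ℝ)) -
          (∫ t in (-h)..0, deriv g ((x + t • EuclideanSpace.single (2 : Fin 3) (1 : ℝ)) 2) * V (x + t • EuclideanSpace.single (2 : Fin 3) (1 : ℝ)) 2) • EuclideanSpace.single (2 : Fin 3) (1 : ℝ))) x⟫) (𝓝[>] 0)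
      (𝓝 (∫ x, ⟪curl v x, curl (fun y : EuclideanSpace ℝ (Fin 3) => -(g (y 2) • fderiv ℝ V y (EuclideanSpace.single (2 : Fin 3) (1 : ℝ)) + deriv g (y 2) • (V y - (V y 2) • EuclideanSpace.single (2 : Fin 3) (1 : ℝ)))) x⟫)) := by
  set e₂ : EuclideanSpace ℝ (Fin 3) := EuclideanSpace.single (2 : Fin 3) (1 : ℝ) with he₂
  have hproj : ContDiff ℝ ∞ fun y : EuclideanSpace ℝ (Fin 3) => y 2 :=
    (EuclideanSpace.proj (2 : Fin 3) : EuclideanSpace ℝ (Fin 3) →L[ℝ] ℝ).contDiff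
  have hγ : ContDiff ℝ ∞ (deriv g) := (contDiff_infty_iff_deriv.mp hg).2
  have hφgs : ContDiff ℝ ∞ (fun y : EuclideanSpace ℝ (Fin 3) => (g (y 2) • fderiv ℝ V y e₂ + deriv g (y 2) • (V y - (V y 2) • e₂))) :=
    ((hg.comp hproj).smul ((hV.fderiv_right (m := ∞) (by exact_mod_cast le_rfl)).clm_apply contDiff_const)).add
      ((hγ.comp hproj).smul (hV.sub ((hproj.comp hV).smul contDiff_const)))
  have hφgd : Differentiable ℝ (fun y : EuclideanSpace ℝ (Fin 3) => (g (y 2) • fderiv ℝ V y e₂ + deriv g (y 2) • (V y - (V y 2) • e₂))) := hφgs.differentiable (by simp)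
  have hψ0s : ContDiff ℝ 1 fun y : EuclideanSpace ℝ (Fin 3) => -(g (y 2) • fderiv ℝ V y e₂ + deriv g (y 2) • (V y - (V y 2) • e₂)) := (hφgs.of_le (WithTop.coe_le_coe.mpr le_top)).neg
  have hDg : Integrable (fun x => ‖fderiv ℝ (fun y : EuclideanSpace ℝ (Fin 3) => (g (y 2) • fderiv ℝ V y e₂ + deriv g (y 2) • (V y - (V y 2) • e₂))) x‖ ^ 2) (volume : Measure (EuclideanSpace ℝ (Fin 3))) :=
    integrable_sq_norm_fderiv_slideGenerator hV hg hK0 hK1 hK2 hK3 hT1 hT2 hT3 h1 h2 hslab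
  have hDneg : ∀ x, fderiv ℝ (fun y : EuclideanSpace ℝ (Fin 3) => -(g (y 2) • fderiv ℝ V y e₂ + deriv g (y 2) • (V y - (V y 2) • e₂))) x = -fderiv ℝ (fun y : EuclideanSpace ℝ (Fin 3) => (g (y 2) • fderiv ℝ V y e₂ + deriv g (y 2) • (V y - (V y 2) • e₂))) x := fun x => fderiv_fun_neg
  have hD0 : Integrable (fun x => ‖fderiv ℝ (fun y : EuclideanSpace ℝ (Fin 3) => -(g (y 2) • fderiv ℝ V y e₂ + deriv g (y 2) • (V y - (V y 2) • e₂))) x‖ ^ 2)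
      (volume : Measure (EuclideanSpace ℝ (Fin 3))) := by
    refine hDg.congr (Eventually.of_forall fun x => ?_)
    show ‖fderiv ℝ (fun y : EuclideanSpace ℝ (Fin 3) => (g (y 2) • fderiv ℝ V y e₂ + deriv g (y 2) • (V y - (V y 2) • e₂))) x‖ ^ 2 = ‖fderiv ℝ (fun y : EuclideanSpace ℝ (Fin 3) => -(g (y 2) • fderiv ℝ V y e₂ + deriv g (y 2) • (V y - (V y 2) • e₂))) x‖ ^ 2
    rw [hDneg, norm_neg]
  have hφhs : ∀ h : ℝ, ContDiff ℝ ∞ (fun x : EuclideanSpace ℝ (Fin 3) => (g (x 2) • V x - g ((x + (-h) • e₂) 2) • V (x + (-h) • e₂) - (∫ t in (-h)..0, deriv g ((x + t • e₂) 2) * V (x + t • e₂) 2) • e₂)) := fun h => contDiff_slideQuotient hV hg h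
  -- the gradient convergence, in real form
  have hT := tendsto_lintegral_fderiv_slideQuotient_sub hV hg hK0 hK1 hK2 hK3 hT1 hT2 hT3 h1 h2 hslab
  have hTr : Tendsto (fun h : ℝ => (∫⁻ x, ‖h⁻¹ • fderiv ℝ (fun x : EuclideanSpace ℝ (Fin 3) => (g (x 2) • V x - g ((x + (-h) • e₂) 2) • V (x + (-h) • e₂) - (∫ t in (-h)..0, deriv g ((x + t • e₂) 2) * V (x + t • e₂) 2) • e₂)) x - fderiv ℝ (fun y : EuclideanSpace ℝ (Fin 3) => (g (y 2) • fderiv ℝ V y e₂ + deriv g (y 2) • (V y - (V y 2) • e₂))) x‖ₑ ^ 2).toReal) (𝓝[>] 0) (𝓝 0) := by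
    have h0 := (ENNReal.tendsto_toReal ENNReal.zero_ne_top).comp hT
    rw [ENNReal.toReal_zero] at h0
    exact h0
  have hbound : Tendsto (fun h : ℝ => 4 * Real.sqrt (∫ x, ‖curl v x‖ ^ 2) *
      Real.sqrt ((∫⁻ x, ‖h⁻¹ • fderiv ℝ (fun x : EuclideanSpace ℝ (Fin 3) => (g (x 2) • V x - g ((x + (-h) • e₂) 2) • V (x + (-h) • e₂) - (∫ t in (-h)..0, deriv g ((x + t • e₂) 2) * V (x + t • e₂) 2) • e₂)) x - fderiv ℝ (fun y : EuclideanSpace ℝ (Fin 3) => (g (y 2) • fderiv ℝ V y e₂ + deriv g (y 2) • (V y - (V y 2) • e₂))) x‖ₑ ^ 2).toReal)) (𝓝[>] 0) (𝓝 0) := by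
    have hs := (Real.continuous_sqrt.tendsto 0).comp hTr
    rw [Real.sqrt_zero] at hs
    have := hs.const_mul (4 * Real.sqrt (∫ x, ‖curl v x‖ ^ 2))
    rw [mul_zero] at this
    exact this
  -- squeeze
  rw [← tendsto_sub_nhds_zero_iff]
  refine squeeze_zero_norm' ?_ hbound
  filter_upwards [eventually_mem_nhdsWithin] with h hh
  have hpos : 0 < h := hh
  have hψs : ContDiff ℝ 1 fun x : EuclideanSpace ℝ (Fin 3) => (-h⁻¹) • (g (x 2) • V x - g ((x + (-h) • e₂) 2) • V (x + (-h) • e₂) - (∫ t in (-h)..0, deriv g ((x + t • e₂) 2) * V (x + t • e₂) 2) • e₂) :=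
    ((hφhs h).const_smul (-h⁻¹)).of_le (WithTop.coe_le_coe.mpr le_top)
  have hDh : Integrable (fun x => ‖fderiv ℝ (fun x : EuclideanSpace ℝ (Fin 3) => (-h⁻¹) • (g (x 2) • V x - g ((x + (-h) • e₂) 2) • V (x + (-h) • e₂) - (∫ t in (-h)..0, deriv g ((x + t • e₂) 2) * V (x + t • e₂) 2) • e₂)) x‖ ^ 2)
      (volume : Measure (EuclideanSpace ℝ (Fin 3))) :=
    integrable_sq_norm_fderiv_slideQuotient_smul hV hg hK0 hK1 hK2 hK3 hT1 hT2 hT3 h1 h2 hslab hpos.le (-h⁻¹)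
  have hle := abs_firstVar_enstrophy_sub_le hv hψs hψ0s hZ hDh hD0
  rw [Real.norm_eq_abs]
  refine hle.trans (le_of_eq ?_)
  congr 2
  -- `∫‖Dψ_h − Dψ₀‖² = (∫⁻‖h⁻¹Dφ̂_h − Dφ_g‖ₑ²).toReal`
  have hφhd : Differentiable ℝ (fun x : EuclideanSpace ℝ (Fin 3) => (g (x 2) • V x - g ((x + (-h) • e₂) 2) • V (x + (-h) • e₂) - (∫ t in (-h)..0, deriv g ((x + t • e₂) 2) * V (x + t • e₂) 2) • e₂)) := (hφhs h).differentiable (by simp)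
  have hDs : ∀ x, fderiv ℝ (fun x : EuclideanSpace ℝ (Fin 3) => (-h⁻¹) • (g (x 2) • V x - g ((x + (-h) • e₂) 2) • V (x + (-h) • e₂) - (∫ t in (-h)..0, deriv g ((x + t • e₂) 2) * V (x + t • e₂) 2) • e₂)) x = (-h⁻¹) • fderiv ℝ (fun x : EuclideanSpace ℝ (Fin 3) => (g (x 2) • V x - g ((x + (-h) • e₂) 2) • V (x + (-h) • e₂) - (∫ t in (-h)..0, deriv g ((x + t • e₂) 2) * V (x + t • e₂) 2) • e₂)) x := fun x =>
    ((hφhd x).hasFDerivAt.const_smul (-h⁻¹)).fderiv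
  have hpt : ∀ x, fderiv ℝ (fun x : EuclideanSpace ℝ (Fin 3) => (-h⁻¹) • (g (x 2) • V x - g ((x + (-h) • e₂) 2) • V (x + (-h) • e₂) - (∫ t in (-h)..0, deriv g ((x + t • e₂) 2) * V (x + t • e₂) 2) • e₂)) x -
      fderiv ℝ (fun y : EuclideanSpace ℝ (Fin 3) => -(g (y 2) • fderiv ℝ V y e₂ + deriv g (y 2) • (V y - (V y 2) • e₂))) x =
      -(h⁻¹ • fderiv ℝ (fun x : EuclideanSpace ℝ (Fin 3) => (g (x 2) • V x - g ((x + (-h) • e₂) 2) • V (x + (-h) • e₂) - (∫ t in (-h)..0, deriv g ((x + t • e₂) 2) * V (x + t • e₂) 2) • e₂)) x - fderiv ℝ (fun y : EuclideanSpace ℝ (Fin 3) => (g (y 2) • fderiv ℝ V y e₂ + deriv g (y 2) • (V y - (V y 2) • e₂))) x) := by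
    intro x
    rw [hDs, hDneg]
    module
  have c1 : Continuous fun x => fderiv ℝ (fun x : EuclideanSpace ℝ (Fin 3) => (g (x 2) • V x - g ((x + (-h) • e₂) 2) • V (x + (-h) • e₂) - (∫ t in (-h)..0, deriv g ((x + t • e₂) 2) * V (x + t • e₂) 2) • e₂)) x := (hφhs h).continuous_fderiv (by simp)
  have c2 : Continuous fun x => h⁻¹ • fderiv ℝ (fun x : EuclideanSpace ℝ (Fin 3) => (g (x 2) • V x - g ((x + (-h) • e₂) 2) • V (x + (-h) • e₂) - (∫ t in (-h)..0, deriv g ((x + t • e₂) 2) * V (x + t • e₂) 2) • e₂)) x := c1.const_smul h⁻¹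
  have c3 : Continuous fun x => fderiv ℝ (fun y : EuclideanSpace ℝ (Fin 3) => (g (y 2) • fderiv ℝ V y e₂ + deriv g (y 2) • (V y - (V y 2) • e₂))) x := hφgs.continuous_fderiv (by simp)
  have hmeas : AEStronglyMeasurable (fun x => h⁻¹ • fderiv ℝ (fun x : EuclideanSpace ℝ (Fin 3) => (g (x 2) • V x - g ((x + (-h) • e₂) 2) • V (x + (-h) • e₂) - (∫ t in (-h)..0, deriv g ((x + t • e₂) 2) * V (x + t • e₂) 2) • e₂)) x - fderiv ℝ (fun y : EuclideanSpace ℝ (Fin 3) => (g (y 2) • fderiv ℝ V y e₂ + deriv g (y 2) • (V y - (V y 2) • e₂))) x)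
      (volume : Measure (EuclideanSpace ℝ (Fin 3))) := (c2.sub c3).aestronglyMeasurable
  refine Eq.trans (integral_congr_ae (Eventually.of_forall fun x => ?_)) (integral_sq_norm_eq_toReal_lintegral hmeas)
  change ‖_‖ ^ 2 = ‖_‖ ^ 2
  rw [hpt, norm_neg]

end ExtremiserLiouville

end Summit.NavierStokesRegularity.NavierStokesRegularity.Theorems

end
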